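import Literature.MathematicalPhysics.QuantumFieldTheory.Balaban1983to89.B9Eq3126H1BlockDecayTowerClosedRadius
import Literature.MathematicalPhysics.QuantumFieldTheory.Balaban1983to89.B9Eq3126H1RowLettersDiagonalClosed

/-!
# `Balaban1983to89.B9Eq3126H1BlockDecayTowerDiagonalClosed` — T. Bałaban, *Propagators for lattice gauge theories in a background field*, Commun. Math. Phys.
# **99** (1985) 389–434 [Balaban1985BackgroundPropagators] (3.126) p. 420, Thm 3.11 p. 416, (3.79) p. 406, (3.49) p. 399 («|G(b, c)| ≤ O(1)e^{−δ₀ d(b,c)} … the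
# constants … independent of the field configuration» and of the step), (3.35)–(3.37) p. 396, with T. Bałaban, *The variational problem and background fields
# in renormalization group method for lattice gauge theories*, Commun. Math. Phys. **102** (1985) 277–309 [Balaban1985Variational] (45)–(46) p. 285 («B₀ …
# uniform»), (136) p. 298: **THE `L²` BLOCK DECAY OF THE MINIMISER's PROPAGATOR `H₁,k(U) = G₁,kQ_k†(Q_kG₁,kQ_k†)⁻¹` ON PRINT's DIAGONAL, FULLY CLOSED —
# `∃ α₀ r₁ A` (closed in the MODEL letters `(d, L, M_φ, M_φ′, M_τ, C_τ, a, a′, ϱ, ρ_w)`) BEFORE every height `n`, spacing `η` (`ηL^{n+1} = 1`), weights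
# (`c₀(L^{n+1})^d = c₁`), lattice `m` and background `U` in the small-field window `‖U(b) − 1‖ ≤ αη`, `‖U(∂p) − 1‖ ≤ αη²`, `‖Ū^j(b) − 1‖ ≤ ε_j ≤ αϱ^j`,
# `α ≤ α₀`: `‖P_{y₁} ∘ H₁,k(U) ∘ r_{y₀}‖ ≤ A·e^{−r₁·d_m(y₀,y₁)}`** — this lineage's `∃ r₀`-first row `B9Eq3126H1BlockDecayTowerClosedRadius` (over the OWNER's
# (H1TC) chain) with its six letter binders INHABITED by `B9Eq3126H1RowLettersDiagonalClosed` (`γ` — OWNER; `μ₁` — ne9-leaf-02's `K`-floor through (MUC); `hpos′`,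
# `κ₁` — the KAPPA1 files; `γ′` — OWNER; `M` — the tower `Q̃′_k` letters; the curvature letter — `B9Ineq369CurvatureSmall`): NO coercivity, floor, size,
# conjugation, window or rate letter displayed — only print's running axioms (E162's `hα1 hU1 hreg` with the per-level regime, the level windows and unit
# ball, unitarity, the trace ∕ fibre normings, `|η|^d∕c₀ ≤ ρ_w`) — the END of road ΔA-CT for `H₁`

statement-level skeleton of published theorems with citation tags; proofs where landed; nothing here is a claim about the Yang–Mills mass gap

CITATION HEADER (lean-in-tree rule).  Audit cell `pub-balaban`, sub-cell `t4`, BINDER row NE9 (road ΔA-CT of the NE9 formalisation swarm, leaf prover 03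
`b2b-balaban-t4-ne9-formalise-leaf-03` gen 77).  Imports BY NAME this lineage's `B9Eq3126H1BlockDecayTowerClosedRadius` (`exists_rate_block_decay_H1k_closed`; through
it the OWNER t4-ne9-p1's (H1TC) chain, (H1DT), (GBT2), (PDCT), ne9-leaf-01's (N51), (CRWT)) and `B9Eq3126H1RowLettersDiagonalClosed`
(`exists_H1_row_letters_diagonal_closed`).  Sources READ first-hand: [Balaban1985BackgroundPropagators] (`paper:balaban1985-cmp99-background-propagators`, journal
page = PDF page + 388) p. 420 (3.126), p. 416 Thm 3.11, p. 406 (3.79), p. 399 (3.49), p. 396 (3.35)–(3.37); [Balaban1985Variational] p. 285 (45)–(46), p. 298 (136).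
Print: the random walk of Sect. C gives the kernel bound with «O(1)» constants; the cell: Combes–Thomas on `L²` blocks with crude closed constants — an
`L²`-operator SHADOW of (3.49)∕(136) for `H₁`, uniform in the height, NOT the pointwise kernel bound.

WHAT IS PROVED (sorry-free; proof lane — no `def`; [folklore] composition BY NAME).
* **`exists_block_decay_H1k_diagonal_closed`** — for `1 ≤ d`, `3 ≤ L`, the fibre ∕ trace letters (`M_φ, M_φ′`, `‖X*‖ ≤ ‖X‖`, `‖τX‖ ≤ C_τ‖X‖`,
  `‖τ(XY)‖ ≤ M_τ‖X‖‖Y‖`, `τ(X*) = conj τX`, `τ(XY) = τ(YX)`, `⟪φ⁻¹X, φ⁻¹Y⟫ = τ(X*Y)`), `a, a′ > 0`, `0 ≤ ϱ < 1`, `ρ_w ≥ 0`: `∃ α₀ r₁ A`, `0 < α₀`, `0 < r₁`,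
  `0 ≤ A`, such that for every `n`, `η` (`ηL^{n+1} = 1`), `c₀, c₁` (`c₀(L^{n+1})^d = c₁`, `|η|^d∕c₀ ≤ ρ_w`), `m` (`1 ≤ m_i`), `U` with E162's data (`0 ≤ α_j ≤ 1∕64`,
  `50(d+1)α_jL^d ≤ ½`, `hU1`, `hreg`), level windows `ε_j` and level unit ball, `0 ≤ α ≤ α₀`, unitary, `U(b) ∈ U1`, `‖U(b) − 1‖ ≤ αη`, `‖U(∂p) − 1‖ ≤ αη²`,
  `ε_j ≤ αϱ^j`, ANY positivity witness `hpos` of `Δ_{a,k}(U)`, the block families `P_y`, `r_y`: `‖P_{y₁} ∘ H₁,k(U) ∘ r_{y₀}‖ ≤ A·exp(−r₁·d_m(y₀,y₁))`.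
HONEST SCOPE.  Composition; crude constants; `L²` block-operator decay only (NOT the kernel bound (46)∕(136), NOT print's `δ₀`); the running axioms stay
displayed; NOT NE9 (cell pub-balaban: NE9 NOT PRINTED ∕ NOT PROVED; «NE9 ⇐ the named binders»; row WALLED ON A MODEL (O-NE9-1; #5 UNRULED); spine PROVED 0∕9;
rung (B)+1 on a finite T⁴ — NOT infinite volume, NOT mass gap, NOT BetaPertH, NOT Clay; HONEST DEPENDENCY: continuum YM on T⁴ ⇐ BetaPertH ∧ nine spine estimates
(0/9 proved); BetaPertH ⇐ (D1) ∧ (D4) ∧ CAP+tail; G-an2-4 gates asym, D1 and NE2/3/4).  NEW file; nothing modified.  Net new unproved facts: 0.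
-/

noncomputable section

set_option autoImplicit false

open scoped InnerProductSpace ComplexConjugate BigOperators
open NormedSpace

namespace Literature.MathematicalPhysics.QuantumFieldTheory.Balaban1983to89.B9Eq3126H1BlockDecayTowerDiagonalClosed

open B4Sect5Torus (TSite tdist)
open B4Sect5Proof (latticeConst latticeConst_nonneg)
open B9SectCLatticeCarrier (Bond DirPair bpos btgt)
open B9Eq311L2Pairing (WL2)
open B9Eq319QprimeTorus (fineP blockCoord)
open B9Eq315QTower (towerP UlevOf)
open B9Eq315QTorus (perCfg cornerSite)
open B7Prop1Explicit (U1 Wcx boxVec)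
open B9Eq316TowerFlatIsOneStep (siteCast towerP_eq_fineP_pow)
open B11Eq103H1Complex (SiteL2K BondL2K)
open B9Eq310DeltaPrime (plaqHolU)
open B9Eq310HessianOperator (adTransportW)
open B9Eq310HessianHermitian (adTransportW_adjoint)
open B9Eq326OperatorTower (laplaceAk H1k QkW QkW_surjective)
open B9Eq3126H1BlockDecayTowerClosedRadius (exists_rate_block_decay_H1k_closed)
open B9Eq3126H1RowLettersDiagonalClosed (exists_H1_row_letters_diagonal_closed)

variable {d : ℕ} (hd : 1 ≤ d) (L : ℕ) [NeZero L] (hL : 1 ≤ L) (hL3 : 3 ≤ L)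
  {𝔸 : Type*} [NormedRing 𝔸] [NormedAlgebra ℂ 𝔸] [CompleteSpace 𝔸] [NormOneClass 𝔸] [StarRing 𝔸] [NormedStarGroup 𝔸] [StarModule ℂ 𝔸]
  {W : Type*} [NormedAddCommGroup W] [InnerProductSpace ℂ W] [FiniteDimensional ℂ W] (φ : W ≃ₗ[ℂ] 𝔸)
  {Mφ Mφ' : ℝ} (hMφ : 0 ≤ Mφ) (hMφ' : 0 ≤ Mφ') (hφ : ∀ w, ‖φ w‖ ≤ Mφ * ‖w‖) (hφ' : ∀ X, ‖φ.symm X‖ ≤ Mφ' * ‖X‖) (hstar : ∀ X : 𝔸, ‖star X‖ ≤ ‖X‖)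
  {a : ℝ} (ha : 0 < a) {a' : ℝ} (ha' : 0 < a') {ϱ : ℝ} (hϱ0 : 0 ≤ ϱ) (hϱ1 : ϱ < 1)
  (τ : 𝔸 →ₗ[ℂ] ℂ) {Cτ : ℝ} (hτ : ∀ X, ‖τ X‖ ≤ Cτ * ‖X‖) (hCτ : 0 ≤ Cτ) {Mτ : ℝ} (hτm : ∀ X Y : 𝔸, ‖τ (X * Y)‖ ≤ Mτ * ‖X‖ * ‖Y‖) (hMτ : 0 ≤ Mτ)
  {ρw : ℝ} (hρw : 0 ≤ ρw)
  (hτ₁ : ∀ X : 𝔸, τ (star X) = conj (τ X)) (hτ₂ : ∀ X Y : 𝔸, τ (X * Y) = τ (Y * X)) (hφτ : ∀ X Y : 𝔸, ⟪φ.symm X, φ.symm Y⟫_ℂ = τ (star X * Y))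

set_option maxHeartbeats 800000 in
include hd hL hL3 hMφ hMφ' hφ hφ' hstar ha ha' hϱ0 hϱ1 hτ hCτ hτm hMτ hρw hτ₁ hτ₂ hφτ in
/-- **THE `L²` BLOCK DECAY OF `H₁,k(U)` ON THE DIAGONAL, FULLY CLOSED — `∃ α₀ r₁ A` BEFORE `∀ n η c₀ c₁ m U`.**  `exists_rate_block_decay_H1k_closed` (the
`∃ r₀`-first row over the OWNER's (H1TC)) at the letters of `exists_H1_row_letters_diagonal_closed` (`γ, μ₁, hpos′, γ′, κ₁, M`, the curvature letter at
`δ := αη²`, `ε_s := α₀`, `p_K⁰ := 768·|DirPair d|·M_τM_φ²ρ_w·α₀ < γ∕2`), `Q_k(U)` onto by `QkW_surjective`, `hRS` from unitarity; rate `r₁ = r₀∕2`, constant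
`A = (4∕γ)e^{r₀}·(C_Qe^{r₀})·(2∕μ₁)e^{r₀}·K_d(r₀∕2)²`. [cite: Balaban1985BackgroundPropagators, (3.126) p.420, Thm 3.11 p.416, (3.79) p.406, (3.49) p.399,
(3.35)–(3.37) p.396; Balaban1985Variational, (45)–(46) p.285, (136) p.298] -/
theorem exists_block_decay_H1k_diagonal_closed :
    ∃ α₀ r₁ A : ℝ, 0 < α₀ ∧ 0 < r₁ ∧ 0 ≤ A ∧
      ∀ (n : ℕ) (η : ℝ) (_hηL : η * (L : ℝ) ^ (n + 1) = 1) (c₀ c₁ : ℝ) [Fact (0 < c₀)] [Fact (0 < c₁)]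
        (_hw : c₀ * ((L : ℝ) ^ (n + 1)) ^ d = c₁) (_hρ : |η| ^ d / c₀ ≤ ρw) (m : Fin d → ℕ) [∀ i, NeZero (m i)] (_hm : ∀ i, 1 ≤ m i)
        (U : Bond d (towerP L m (n + 1)) → 𝔸ˣ) (αU : ℕ → ℝ) (_hα0 : ∀ j, 0 ≤ αU j) (hα1 : ∀ j, αU j ≤ 1 / 64)
        (hαL : ∀ j, 50 * (d + 1) * αU j * (L : ℝ) ^ d ≤ 1 / 2)
        (hU1 : ∀ (j : ℕ) (x : B7Prop1Explicit.Site d) (k : Fin d), perCfg (towerP L m (j + 1)) (UlevOf L m (n + 1) U j) x k ∈ U1 𝔸)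
        (hreg : ∀ (j : ℕ) (y : TSite d (towerP L m j)) (k : Fin d) (ρ' : Fin d → Fin L),
          ‖((Wcx L (perCfg (towerP L m (j + 1)) (UlevOf L m (n + 1) U j)) (cornerSite L y) k (boxVec L ρ') : 𝔸ˣ) : 𝔸) - 1‖ ≤ αU j)
        (εU : ℕ → ℝ) (_hεU : ∀ j, 0 ≤ εU j) (_hUε : ∀ (j : ℕ) (b : Bond d (towerP L m (j + 1))), ‖(UlevOf L m (n + 1) U j b : 𝔸) - 1‖ ≤ εU j)
        (_hLb : ∀ (j : ℕ) (b : Bond d (towerP L m (j + 1))), UlevOf L m (n + 1) U j b ∈ U1 𝔸)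
        (α : ℝ) (_hα : 0 ≤ α) (_hαle : α ≤ α₀)
        (_hUst : ∀ b, star (U b : 𝔸) = (((U b)⁻¹ : 𝔸ˣ) : 𝔸)) (_hUb : ∀ b, U b ∈ U1 𝔸) (_hUη : ∀ b, ‖(U b : 𝔸) - 1‖ ≤ α * η)
        (_hpl : ∀ p : B9SectCLatticeCarrier.Plaq d (towerP L m (n + 1)), ‖(plaqHolU U p : 𝔸) - 1‖ ≤ α * η ^ 2)
        (_hεg : ∀ j < n + 1, εU j ≤ α * ϱ ^ j)
        (hpos : ∀ x : BondL2K ℂ d (towerP L m (n + 1)) c₀ W, x ≠ 0 →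
          0 < RCLike.re ⟪x, laplaceAk L m n φ η U hL αU hα1 hU1 hreg τ (c₀ := c₀) (c₁ := c₁) a x⟫_ℂ)
        (PB : TSite d m → BondL2K ℂ d (towerP L m (n + 1)) c₀ W →L[ℂ] BondL2K ℂ d (towerP L m (n + 1)) c₀ W)
        (_hPB : ∀ (y : TSite d m) (f : BondL2K ℂ d (towerP L m (n + 1)) c₀ W) (b : Bond d (towerP L m (n + 1))),
          WL2.equiv ℂ (fun _ : Bond d (towerP L m (n + 1)) => c₀) W (PB y f) b =
            if blockCoord (L ^ (n + 1)) m (siteCast (towerP_eq_fineP_pow L m (n + 1)) (bpos b)) = y then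
              WL2.equiv ℂ (fun _ : Bond d (towerP L m (n + 1)) => c₀) W f b else 0)
        (rF : TSite d m → BondL2K ℂ d m c₁ W →L[ℂ] BondL2K ℂ d m c₁ W)
        (_hrF : ∀ (y : TSite d m) (g : BondL2K ℂ d m c₁ W) (b' : Bond d m),
          WL2.equiv ℂ (fun _ : Bond d m => c₁) W (rF y g) b' = if bpos b' = y then WL2.equiv ℂ (fun _ : Bond d m => c₁) W g b' else 0)
        (y₀ y₁ : TSite d m),
        ‖PB y₁ ∘L LinearMap.toContinuousLinearMap (H1k L m n φ η U hL αU hα1 hU1 hreg τ (c₀ := c₀) (c₁ := c₁) hαL hpos) ∘L rF y₀‖ ≤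
          A * Real.exp (-(r₁ * tdist m y₀ y₁)) := by
  have hL2 : 2 ≤ L := le_trans (by norm_num) hL3
  -- the six letters, closed in one window
  obtain ⟨α₀, γ, μ₁, γ', κ₁, M, hα₀, hγ, hγ1, hμ₁, hγ', hγ'1, hκ₁, hM, hgap, HL⟩ :=
    exists_H1_row_letters_diagonal_closed hd L hL hL3 φ hMφ hMφ' hφ hφ' ha ha' hϱ0 hϱ1 τ hτ hCτ hρw hτ₁ hτ₂ hφτ hMτ
  have hP0 : 0 ≤ 768 * Fintype.card (DirPair d) * Mτ * Mφ ^ 2 * ρw * α₀ := by positivity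
  -- the radius, chosen once
  obtain ⟨r₀, -, hr₀, HE⟩ := exists_rate_block_decay_H1k_closed L hL2 φ hφ hφ' hMφ hMφ' hstar τ hτm hMτ a ha.le ha'.le hϱ0 hϱ1 hα₀.le hγ' hγ'1 hκ₁ hM
    hγ hγ1 hμ₁ hP0 hgap d
  refine ⟨α₀, r₀ / 2, (4 / γ * Real.exp r₀) * ((Mφ' * Mφ * Real.exp (Real.sqrt ((L : ℝ) ^ d) * (Real.sqrt (2 * d) * (102 * (d + 1) ^ 2 * L)) * (α₀ / (1 - ϱ)))) * Real.exp r₀) * (2 / μ₁ * Real.exp r₀) *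
    latticeConst d (r₀ / 2) ^ 2, hα₀, by positivity, ?_, ?_⟩
  · have h1 : 0 ≤ latticeConst d (r₀ / 2) ^ 2 := sq_nonneg _
    have h2 : 0 ≤ 4 / γ * Real.exp r₀ := by positivity
    have h3 : 0 ≤ 2 / μ₁ * Real.exp r₀ := by positivity
    positivity
  intro n η hηL c₀ c₁ _ _ hw hρ m _ hm U αU hαU0 hα1 hαL hU1 hreg εU hεU hUε hLb α hα hαle hUst hUb hUη hpl hεg hpos PB hPB rF hrF y₀ y₁
  obtain ⟨hcoer, hX1, hpos', coercive, hκ, hMQ, hRe, hIm, hpK⟩ :=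
    HL n η hηL c₀ c₁ hw hρ m U αU hα1 hU1 hreg εU hεU hUε hLb hα hαle hUst hUb hUη hpl hεg
  have hRS : ∀ (b : Bond d (towerP L m (n + 1))) (v u : W), ⟪adTransportW φ U b v, u⟫_ℂ = ⟪v, adTransportW φ (fun b => (U b)⁻¹) b u⟫_ℂ :=
    adTransportW_adjoint φ τ hτ₂ hUst hφτ
  have hη : 0 < η := by
    have hLp : (0 : ℝ) < (L : ℝ) ^ (n + 1) := by positivity
    by_contra h
    have : η * (L : ℝ) ^ (n + 1) ≤ 0 := mul_nonpos_of_nonpos_of_nonneg (not_lt.mp h) hLp.le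
    linarith
  have hεg' : ∀ j < n + 1, εU j ≤ α₀ * ϱ ^ j := fun j hj => (hεg j hj).trans (mul_le_mul_of_nonneg_right hαle (pow_nonneg hϱ0 j))
  have hδ : 0 ≤ α * η ^ 2 := by positivity
  have hQ := QkW_surjective L m n φ U hL αU hα1 hU1 hreg (c₀ := c₀) (c₁ := c₁) hαL
  exact HE n η hη hηL c₀ c₁ hw m hm U hUb hRS αU hαU0 hα1 hαL hU1 hreg εU hεU hUε hεg' (α * η ^ 2) hδ hRe hIm hpK hpos' coercive (hκ hpos') hMQ hpos hcoer
    (hX1 hpos hQ) PB hPB rF hrF y₀ y₁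

end Literature.MathematicalPhysics.QuantumFieldTheory.Balaban1983to89.B9Eq3126H1BlockDecayTowerDiagonalClosed

end
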